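import Summits.CriticalPhenomena.CardyFormulaZ2.Theorems.CardyIKTransportIKMixedBoxCrossingDefectGlueDefs
import Summits.CriticalPhenomena.CardyFormulaZ2.Theorems.CardyIKTransportIKMixedBoxCrossingDefectStubCondBox

/-!
# Stub `stub_rowFactorisation` of the line `defect-closure-exploration` (crux `IKMixedBoxCrossing`,
# stmt-CriticalPhenomena-5911)

ROW FACTORISATION (exact Markov property of the gauge colour field across the cell row `0`, finite cylinder form,
every column pattern `S`): for an event `A` read on the upper half-box `U = [a, a+k) × [1, h]`, an event `B` read on
the lower half-box `L = [a, a+k) × [-h, -1]` and the axis cylinder `C_ξ` (colours `ξ` of the cells `(a+i, 0)`,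
`i < k`): `ν(A ∩ B ∩ C_ξ) = 2^k ν(A ∩ C_ξ) ν(B ∩ C_ξ)`.

PROOF (bit bookkeeping, no conditional measures). Write `ω = (A, B, Pb, Pf, C)` (column / row signs, biased / fair
plaquettes, coins) and SHEAR the row signs, `B j ↦ B j ⊕ B 0` for `j ≠ 0` (`RowTwistStub.measurePreserving_shearΩ`,
`μIK`-preserving), so `ν(E ∩ C_ξ) = μIK(shear⁻¹ (obs⁻¹ (E ∩ C_ξ)))`. After the shear:
* the axis cell `(x, 0)` is black iff `A x ⊕ B 0` (`axis_sheared`): `C_ξ` pulls back to the cylinder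
  `Cyl = {A (a+i) ⊕ B 0 = ξ_i ∀ i}`, which reads the column signs and `B 0` only and has mass `2^{-k}`
  (`real_colCyl`: a column-sign cylinder for either value of `B 0`);
* a cell `v = (a+i, j)`, `j ≠ 0`, is black iff `ξ_i ⊕ B j ⊕` (parity of the plaquettes of the anchored rectangle of
  `v`) on `Cyl` (`colour_sheared`, i.e. `RowTwistStub.xor_twist_shear`): off the axis, the colours of the window
  columns are those of ONE synthetic configuration `tw ω` reading neither `A` nor `B 0`, so that
  `shear⁻¹ (obs⁻¹ (E ∩ C_ξ)) = tw⁻¹ E ∩ Cyl` for every event `E` determined off the axis (`A`, `B`, `A ∩ B`);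
* `tw⁻¹ A` reads `B` on `j ≥ 1`, the plaquettes of the face rows `≥ 0` and the coins of the face rows `≥ 1`;
  `tw⁻¹ B` reads `B` on `j ≤ -1` and the plaquettes and coins of the face rows `≤ -1`; `Cyl` reads `A` and `B 0`:
  DISJOINT coordinate sets of the product measure, hence independent (`CondBoxStub.real_inter_eq_mul`).
Therefore `ν(A ∩ B ∩ C_ξ) = μ(tw⁻¹A) μ(tw⁻¹B) 2^{-k}`, `ν(A ∩ C_ξ) = μ(tw⁻¹A) 2^{-k}`, `ν(B ∩ C_ξ) = μ(tw⁻¹B) 2^{-k}`.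
-/

noncomputable section

namespace Summit.CriticalPhenomena.CardyFormulaZ2.Cruxes.IKMixedBoxCrossing.DefectClosureExploration

open scoped Classical BigOperators
open MeasureTheory ProbabilityTheory
open Literature.Probability.Percolation Literature.Probability.LatticeModels
open Summit.CriticalPhenomena.CardyFormulaZ2.Theorems.IKLinearTransport.PinnedDiagramExchange (Ω μIK blackSet parSet
  antiSet Obs obs νmix determinedOn)
open Summit.CriticalPhenomena.CardyFormulaZ2.Theorems.IKLinearTransport.PinnedDiagramExchange.CouplingToLimits
  (measurable_xor measurable_mem_parSet measurable_mem_antiSet measurable_card_filter isProbabilityMeasure_μIK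
    measurable_obs)
open Summit.CriticalPhenomena.CardyFormulaZ2.Cruxes.IKMixedBoxCrossing.XorRectangleFlip.IncrStub (mem_parSet_congr)

namespace RowFactorisationStub

/-! ## §1 Small tools -/

/-- Solving `P ⊕ Q = R` for `P`. -/
theorem iff_xor_of_xor_iff {P Q R : Prop} (h : Xor P Q ↔ R) : (P ↔ Xor Q R) := by
  grind

/-- Solving `P ⊕ Q = b` for `P` when `Q` is tracked by the Boolean `q`. -/
theorem xor_iff_iff {P Q : Prop} {q : Bool} (hq : Q ↔ q = true) (b : Bool) :
    (Xor P Q ↔ b = true) ↔ (P ↔ xor b q = true) := by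
  grind

/-- Locality of the anti-diagonal set: membership of `f` reads the coin at `f` only. -/
theorem mem_antiSet_congr (S : Set ℤ) {ω ω' : Ω} {f : Site 2} (h : (f ∈ ω'.2.2.2.2 ↔ f ∈ ω.2.2.2.2)) :
    (f ∈ antiSet S ω' ↔ f ∈ antiSet S ω) := by
  simp only [antiSet, Set.mem_setOf_eq, h]

/-- Membership in the upper half-box. -/
theorem mem_upBox {a : ℤ} {k h : ℕ} {v : Site 2} :
    v ∈ upBox a k h ↔ a ≤ v 0 ∧ v 0 < a + k ∧ 1 ≤ v 1 ∧ v 1 ≤ h := Iff.rfl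

/-- Membership in the lower half-box. -/
theorem mem_loBox {a : ℤ} {k h : ℕ} {v : Site 2} :
    v ∈ loBox a k h ↔ a ≤ v 0 ∧ v 0 < a + k ∧ -(h : ℤ) ≤ v 1 ∧ v 1 ≤ -1 := Iff.rfl

/-! ## §2 Colours after the row-sign shear -/

/-- AXIS after the shear: `(x, 0)` is black iff `A x ⊕ B 0` (the shear fixes the axis). -/
theorem axis_sheared (S : Set ℤ) (ω : Ω) (x : ℤ) :
    ((![x, 0] : Site 2) ∈ blackSet S ((ω.1, ({y : ℤ | Xor (y ∈ ω.2.1) ((0 : ℤ) ∈ ω.2.1 ∧ y ≠ 0)}, ω.2.2)) : Ω) ↔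
      Xor (x ∈ ω.1) ((0 : ℤ) ∈ ω.2.1)) := by
  rw [RowTwistStub.mem_blackSet_shear, RowTwistStub.mem_blackSet_row0]
  exact RowTwistStub.xor_iff_left_of_not fun h => h.2 rfl

/-- OFF THE AXIS after the shear: if the axis cell of the column of `v` reads `b`, then `v` (`v 1 ≠ 0`) is black iff
`b ⊕ B (v 1) ⊕` (parity of the plaquettes of the anchored rectangle of `v`) — neither column sign nor `B 0`. -/
theorem colour_sheared (S : Set ℤ) (ω : Ω) (v : Site 2) (hv : v 1 ≠ 0) {b : Bool}
    (hb : Xor (v 0 ∈ ω.1) ((0 : ℤ) ∈ ω.2.1) ↔ b = true) :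
    (v ∈ blackSet S ((ω.1, ({y : ℤ | Xor (y ∈ ω.2.1) ((0 : ℤ) ∈ ω.2.1 ∧ y ≠ 0)}, ω.2.2)) : Ω) ↔
      Xor (b = true) (Xor (v 1 ∈ ω.2.1)
        (Odd ((Finset.Ico (min 0 (v 0)) (max 0 (v 0)) ×ˢ Finset.Ico (min 0 (v 1)) (max 0 (v 1))).filter
          (fun f : ℤ × ℤ => (![f.1, f.2] : Site 2) ∈ parSet S ω)).card))) := by
  have h := RowTwistStub.xor_twist_shear S ω v hv
  rw [axis_sheared, hb] at h
  exact iff_xor_of_xor_iff h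

/-! ## §3 The factorisation -/

/-- Mass of a column-sign cylinder on the `k` window columns: `2^{-k}`. -/
theorem real_colCyl (a : ℤ) (k : ℕ) (η : Fin k → Bool) :
    μIK.real {ω : Ω | ∀ i : Fin k, (a + i ∈ ω.1 ↔ η i = true)} = (1 / 2) ^ k := by
  have h1 := (by unfold μIK; exact measurePreserving_fst :
    MeasurePreserving (fun ω : Ω => ω.1) μIK _).measureReal_preimage
    (s := {T : Set ℤ | ∀ i : Fin k, (a + i ∈ T ↔ η i = true)})
    (measurableSet_setOf.2 (Measurable.forall fun i => (measurable_set_mem _).iff measurable_const)).nullMeasurableSet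
  rw [CondBoxStub.sitePercolation_real_cylinder half (e := fun i : Fin k => a + ((i : ℕ) : ℤ))
    (fun i j hij => Fin.ext (by simp only [add_right_inj, Nat.cast_inj] at hij; exact hij)) η] at h1
  rw [show {ω : Ω | ∀ i : Fin k, (a + i ∈ ω.1 ↔ η i = true)} =
      (fun ω : Ω => ω.1) ⁻¹' {T | ∀ i : Fin k, (a + i ∈ T ↔ η i = true)} from rfl, h1,
    Finset.prod_congr rfl fun i _ => show (if η i then ((half : unitInterval) : ℝ) else 1 - half) = 1 / 2 by
      cases η i <;> norm_num [half], Finset.prod_const, Finset.card_univ, Fintype.card_fin]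

/-- The factorisation `ν(A ∩ B ∩ C_ξ) = 2^k ν(A ∩ C_ξ) ν(B ∩ C_ξ)` for events of the two half-boxes. -/
theorem main (S : Set ℤ) (a : ℤ) (k h : ℕ) {A B : Set Obs} (hAm : MeasurableSet A) (hBm : MeasurableSet B)
    (hA : A ∈ determinedOn (upBox a k h)) (hB : B ∈ determinedOn (loBox a k h)) (ξ : Fin k → Bool) :
    (νmix S).real (A ∩ B ∩ rowCyl a k ξ) =
      (2 : ℝ) ^ k * (νmix S).real (A ∩ rowCyl a k ξ) * (νmix S).real (B ∩ rowCyl a k ξ) := by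
  haveI := isProbabilityMeasure_μIK
  -- VOCABULARY: the shear, the rectangle parities, the synthetic configuration, the axis cylinder
  set σ : Ω → Ω := fun ω => ((ω.1, ({y : ℤ | Xor (y ∈ ω.2.1) ((0 : ℤ) ∈ ω.2.1 ∧ y ≠ 0)}, ω.2.2)) : Ω)
  set RP : Site 2 → Ω → Prop := fun v ω =>
    Odd (((Finset.Ico (min 0 (v 0)) (max 0 (v 0)) ×ˢ Finset.Ico (min 0 (v 1)) (max 0 (v 1))).filter
      fun f : ℤ × ℤ => (![f.1, f.2] : Site 2) ∈ parSet S ω).card) with hRP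
  set tw : Ω → Obs := fun ω =>
    ({v | ∃ i : Fin k, v 0 = a + i ∧ Xor (ξ i = true) (Xor (v 1 ∈ ω.2.1) (RP v ω))}, antiSet S ω) with htw
  set Cyl : Set Ω := {ω | ∀ i : Fin k, (Xor (a + i ∈ ω.1) ((0 : ℤ) ∈ ω.2.1) ↔ ξ i = true)}
  -- MEASURABILITY
  have mB : ∀ y : ℤ, Measurable fun ω : Ω => y ∈ ω.2.1 := fun y => (measurable_set_mem y).comp measurable_snd.fst
  have mRP : ∀ v, Measurable (RP v) := fun v =>
    (measurable_of_countable fun n : ℕ => Odd n).comp (measurable_card_filter _ fun f => measurable_mem_parSet S _)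
  have mtw : Measurable tw :=
    (measurable_set_iff.2 fun v => Measurable.exists fun i => measurable_const.and
      (measurable_xor measurable_const (measurable_xor (mB _) (mRP v)))).prodMk
      (measurable_set_iff.2 (measurable_mem_antiSet S))
  have mCyl : MeasurableSet Cyl := measurableSet_setOf.2 (Measurable.forall fun i =>
    (measurable_xor ((measurable_set_mem _).comp measurable_fst) (mB 0)).iff measurable_const)
  have mrow : MeasurableSet (rowCyl a k ξ) := measurableSet_setOf.2
    (Measurable.forall fun i => ((measurable_set_mem _).comp measurable_fst).iff measurable_const)
  -- AXIS after the shear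
  have hax : ∀ (ω : Ω) (x : ℤ), ((![x, 0] : Site 2) ∈ blackSet S (σ ω) ↔ Xor (x ∈ ω.1) ((0 : ℤ) ∈ ω.2.1)) :=
    fun ω x => axis_sheared S ω x
  -- THE SYNTHETIC CONFIGURATION agrees with the sheared observables off the axis, on `Cyl`
  have hkey : ∀ {E : Set Obs} {Λ : Set (Site 2)}, E ∈ determinedOn Λ →
      (∀ v ∈ Λ, a ≤ v 0 ∧ v 0 < a + k ∧ v 1 ≠ 0) → ∀ ω ∈ Cyl, (obs S (σ ω) ∈ E ↔ tw ω ∈ E) := by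
    intro E Λ hE hΛ ω hω
    refine hE (obs S (σ ω)) (tw ω) fun v hv => ⟨?_, Iff.rfl⟩
    obtain ⟨h0, h1, h2⟩ := hΛ v hv
    obtain ⟨i, hi⟩ : ∃ i : Fin k, v 0 = a + i :=
      ⟨⟨(v 0 - a).toNat, by omega⟩, by simp only [Int.toNat_of_nonneg (by omega : (0:ℤ) ≤ v 0 - a)]; omega⟩
    refine (colour_sheared S ω v h2 (b := ξ i) (by rw [hi]; exact hω i)).trans ⟨fun hx => ⟨i, hi, hx⟩, ?_⟩
    rintro ⟨i', hi', hx⟩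
    obtain rfl : i' = i := Fin.ext (by omega)
    exact hx
  -- TRANSPORT: `ν(E ∩ C_ξ) = μIK (shear⁻¹ (obs⁻¹ (E ∩ C_ξ))) = μIK (tw⁻¹ E ∩ Cyl)`
  have hν : ∀ {E : Set Obs}, MeasurableSet E → (∀ ω ∈ Cyl, (obs S (σ ω) ∈ E ↔ tw ω ∈ E)) →
      (νmix S).real (E ∩ rowCyl a k ξ) = μIK.real (tw ⁻¹' E ∩ Cyl) := by
    intro E hEm hE
    have hm : MeasurableSet (E ∩ rowCyl a k ξ) := hEm.inter mrow
    have hpre : σ ⁻¹' (obs S ⁻¹' (E ∩ rowCyl a k ξ)) = tw ⁻¹' E ∩ Cyl := by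
      ext ω
      have hc : obs S (σ ω) ∈ rowCyl a k ξ ↔ ω ∈ Cyl := forall_congr' fun i => iff_congr (hax ω (a + i)) Iff.rfl
      simp only [Set.mem_preimage, Set.mem_inter_iff]
      exact ⟨fun hx => ⟨(hE ω (hc.1 hx.2)).1 hx.1, hc.1 hx.2⟩, fun hx => ⟨(hE ω hx.2).2 hx.1, hc.2 hx.2⟩⟩
    rw [show νmix S = μIK.map (obs S) from rfl, map_measureReal_apply (measurable_obs S) hm,
      ← RowTwistStub.measurePreserving_shearΩ.measureReal_preimage (measurable_obs S hm).nullMeasurableSet]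
    exact congrArg μIK.real hpre
  -- LOCALITY of the synthetic configuration: it reads `B (v 1)`, the plaquettes of the anchored rectangle, the coin
  have hproj : ∀ {E : Set Obs} {Λ : Set (Site 2)}, E ∈ determinedOn Λ → ∀ (Bs As : Set ℤ) (F C : Set (Site 2)),
      (∀ v ∈ Λ, v 1 ∈ Bs) →
      (∀ v ∈ Λ, ∀ f : ℤ × ℤ, f.2 ∈ Finset.Ico (min 0 (v 1)) (max 0 (v 1)) → (![f.1, f.2] : Site 2) ∈ F) →
      (∀ v ∈ Λ, v ∈ C) → ∀ ω : Ω,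
        (tw ((ω.1 ∩ As, (ω.2.1 ∩ Bs, (ω.2.2.1 ∩ F, (ω.2.2.2.1 ∩ F, ω.2.2.2.2 ∩ C)))) : Ω) ∈ E ↔ tw ω ∈ E) := by
    intro E Λ hE Bs As F C hBs hF hC ω
    have hP : ∀ g : Site 2, g ∈ F →
        (g ∈ parSet S ((ω.1 ∩ As, (ω.2.1 ∩ Bs, (ω.2.2.1 ∩ F, (ω.2.2.2.1 ∩ F, ω.2.2.2.2 ∩ C)))) : Ω) ↔
          g ∈ parSet S ω) :=
      fun g hg => mem_parSet_congr S ⟨fun h => h.1, fun h => ⟨h, hg⟩⟩ ⟨fun h => h.1, fun h => ⟨h, hg⟩⟩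
    refine hE _ _ fun v hv => ⟨?_, mem_antiSet_congr S ⟨fun h => h.1, fun h => ⟨h, hC v hv⟩⟩⟩
    simp only [htw, hRP, Set.mem_setOf_eq]
    refine exists_congr fun i => and_congr_right fun _ => CondBoxStub.xor_congr' Iff.rfl
      (CondBoxStub.xor_congr' ⟨fun h => h.1, fun h => ⟨h, hBs v hv⟩⟩ ?_)
    rw [Finset.filter_congr fun f hf => hP _ (hF v hv f (Finset.mem_product.1 hf).2)]
  -- INDEPENDENCE (disjoint coordinates): off-axis events vs the axis cylinder, upper vs lower
  have hindC : ∀ X : Set Ω, MeasurableSet X →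
      (∀ ω : Ω, ((ω.1 ∩ ∅, (ω.2.1 ∩ {y | y ≠ 0}, (ω.2.2.1 ∩ Set.univ, (ω.2.2.2.1 ∩ Set.univ,
        ω.2.2.2.2 ∩ Set.univ)))) : Ω) ∈ X ↔ ω ∈ X) →
      μIK.real (X ∩ Cyl) = μIK.real X * μIK.real Cyl := fun X hX hX' =>
    CondBoxStub.real_inter_eq_mul (A₁ := ∅) (A₂ := Set.univ) (B₁ := {y | y ≠ 0}) (B₂ := {y | y = 0})
      (P₁ := Set.univ) (P₂ := ∅) (Q₁ := Set.univ) (Q₂ := ∅) (C₁ := Set.univ) (C₂ := ∅) disjoint_bot_left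
      (Set.disjoint_left.2 fun y (hy : y ≠ 0) (hy' : y = 0) => hy hy') disjoint_bot_right disjoint_bot_right
      disjoint_bot_right hX mCyl hX' fun ω => forall_congr' fun i => iff_congr (CondBoxStub.xor_congr'
        ⟨fun h => h.1, fun h => ⟨h, Set.mem_univ _⟩⟩ ⟨fun h => h.1, fun h => ⟨h, rfl⟩⟩) Iff.rfl
  have hindAB : μIK.real (tw ⁻¹' A ∩ tw ⁻¹' B) = μIK.real (tw ⁻¹' A) * μIK.real (tw ⁻¹' B) :=
    CondBoxStub.real_inter_eq_mul (A₁ := ∅) (A₂ := ∅) (B₁ := {y | 1 ≤ y}) (B₂ := {y | y ≤ -1})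
      (P₁ := {f | 0 ≤ f 1}) (P₂ := {f | f 1 < 0}) (Q₁ := {f | 0 ≤ f 1}) (Q₂ := {f | f 1 < 0}) (C₁ := {f | 1 ≤ f 1})
      (C₂ := {f | f 1 ≤ -1}) disjoint_bot_left (Set.disjoint_left.2 fun y (hy : 1 ≤ y) (hy' : y ≤ -1) => by omega)
      (Set.disjoint_left.2 fun f (hf : 0 ≤ f 1) (hf' : f 1 < 0) => by omega)
      (Set.disjoint_left.2 fun f (hf : 0 ≤ f 1) (hf' : f 1 < 0) => by omega)
      (Set.disjoint_left.2 fun f (hf : 1 ≤ f 1) (hf' : f 1 ≤ -1) => by omega) (mtw hAm) (mtw hBm)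
      (hproj hA {y | 1 ≤ y} ∅ {f | 0 ≤ f 1} {f | 1 ≤ f 1} (fun v hv => (mem_upBox.1 hv).2.2.1)
        (fun v hv f hf => RowTwistStub.faces_upper _ (by have := (mem_upBox.1 hv).2.2.1; omega) f hf)
        fun v hv => (mem_upBox.1 hv).2.2.1)
      (hproj hB {y | y ≤ -1} ∅ {f | f 1 < 0} {f | f 1 ≤ -1} (fun v hv => (mem_loBox.1 hv).2.2.2)
        (fun v hv f hf => RowTwistStub.faces_lower _ (by have := (mem_loBox.1 hv).2.2.2; omega) f hf)
        fun v hv => (mem_loBox.1 hv).2.2.2)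
  -- MASS OF THE AXIS CYLINDER: `2^{-k}` (a column-sign cylinder for either value of `B 0`)
  have hCylval : μIK.real Cyl = (1 / 2) ^ k := by
    have mB0 : MeasurableSet {ω : Ω | (0 : ℤ) ∈ ω.2.1} := measurableSet_setOf.2 (mB 0)
    have hsplit : ∀ (q : Bool) (Y : Set Ω), MeasurableSet Y → (∀ ω ∈ Y, ((0 : ℤ) ∈ ω.2.1 ↔ q = true)) →
        (∀ ω : Ω, ((ω.1 ∩ ∅, (ω.2.1 ∩ Set.univ, (ω.2.2.1 ∩ ∅, (ω.2.2.2.1 ∩ ∅, ω.2.2.2.2 ∩ ∅)))) : Ω) ∈ Y ↔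
          ω ∈ Y) → μIK.real (Cyl ∩ Y) = (1 / 2) ^ k * μIK.real Y := by
      intro q Y hY hq hY'
      have he : Cyl ∩ Y = {ω : Ω | ∀ i : Fin k, (a + i ∈ ω.1 ↔ xor (ξ i) q = true)} ∩ Y := by
        ext ω
        constructor
        · rintro ⟨hc, hy⟩; exact ⟨fun i => (xor_iff_iff (hq ω hy) (ξ i)).1 (hc i), hy⟩
        · rintro ⟨hc, hy⟩; exact ⟨fun i => (xor_iff_iff (hq ω hy) (ξ i)).2 (hc i), hy⟩
      rw [he, ← real_colCyl a k fun i => xor (ξ i) q]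
      exact CondBoxStub.real_inter_eq_mul (A₁ := Set.univ) (A₂ := ∅) (B₁ := ∅) (B₂ := Set.univ) (P₁ := ∅)
        (P₂ := ∅) (Q₁ := ∅) (Q₂ := ∅) (C₁ := ∅) (C₂ := ∅) disjoint_bot_right disjoint_bot_left disjoint_bot_left
        disjoint_bot_left disjoint_bot_left (measurableSet_setOf.2 (Measurable.forall fun i =>
          ((measurable_set_mem _).comp measurable_fst).iff measurable_const)) hY
        (fun ω => forall_congr' fun i => iff_congr ⟨fun h => h.1, fun h => ⟨h, Set.mem_univ _⟩⟩ Iff.rfl) hY'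
    rw [← measureReal_inter_add_sdiff (μ := μIK) (s := Cyl) mB0, Set.sdiff_eq,
      hsplit true _ mB0 (fun ω hω => ⟨fun _ => rfl, fun _ => hω⟩)
        (fun ω => ⟨fun h => h.1, fun h => ⟨h, Set.mem_univ _⟩⟩),
      hsplit false _ mB0.compl (fun ω hω => ⟨fun h => absurd h hω, fun h => absurd h Bool.false_ne_true⟩)
        (fun ω => not_congr ⟨fun h => h.1, fun h => ⟨h, Set.mem_univ _⟩⟩),
      ← mul_add, measureReal_add_measureReal_compl mB0, probReal_univ, mul_one]
  -- ASSEMBLY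
  have hoffU : ∀ v ∈ upBox a k h, a ≤ v 0 ∧ v 0 < a + k ∧ v 1 ≠ 0 := fun v hv =>
    ⟨(mem_upBox.1 hv).1, (mem_upBox.1 hv).2.1, by have := (mem_upBox.1 hv).2.2.1; omega⟩
  have hoffL : ∀ v ∈ loBox a k h, a ≤ v 0 ∧ v 0 < a + k ∧ v 1 ≠ 0 := fun v hv =>
    ⟨(mem_loBox.1 hv).1, (mem_loBox.1 hv).2.1, by have := (mem_loBox.1 hv).2.2.2; omega⟩
  have hkA := hkey hA hoffU
  have hkB := hkey hB hoffL
  have hXA := hproj hA {y : ℤ | y ≠ 0} ∅ Set.univ Set.univ (fun v hv => (hoffU v hv).2.2)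
    (fun _ _ _ _ => Set.mem_univ _) fun _ _ => Set.mem_univ _
  have hXB := hproj hB {y : ℤ | y ≠ 0} ∅ Set.univ Set.univ (fun v hv => (hoffL v hv).2.2)
    (fun _ _ _ _ => Set.mem_univ _) fun _ _ => Set.mem_univ _
  rw [hν (hAm.inter hBm) (fun ω hω => and_congr (hkA ω hω) (hkB ω hω)), hν hAm hkA, hν hBm hkB,
    Set.preimage_inter, hindC _ ((mtw hAm).inter (mtw hBm)) (fun ω => and_congr (hXA ω) (hXB ω)),
    hindC _ (mtw hAm) hXA, hindC _ (mtw hBm) hXB, hindAB, hCylval]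
  have h2 : (2 : ℝ) ^ k * (1 / 2) ^ k = 1 := by rw [← mul_pow]; norm_num
  generalize μIK.real (tw ⁻¹' A) = x
  generalize μIK.real (tw ⁻¹' B) = y
  linear_combination (-(x * y * (1 / 2 : ℝ) ^ k)) * h2

end RowFactorisationStub

/-- **Registered stub `stub_rowFactorisation`** (ROW FACTORISATION, line `defect-closure-exploration`): the exact
Markov property of the gauge colour field across the cell row `0` in finite cylinder form, for every column pattern
`S` — given the colours of the axis window, an event read on the upper half-box and an event read on the lower
half-box are independent and the window is uniform: `ν(A ∩ B ∩ C_ξ) = 2^k ν(A ∩ C_ξ) ν(B ∩ C_ξ)`. -/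
theorem stub_rowFactorisation : RowFactorisation := by
  intro S a k h A B hAm hBm hA hB ξ
  exact RowFactorisationStub.main S a k h hAm hBm hA hB ξ

end Summit.CriticalPhenomena.CardyFormulaZ2.Cruxes.IKMixedBoxCrossing.DefectClosureExploration

end
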